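import Summits.QuantumFields.QCD.Theses.PauliWegnerSea
import Literature.MathematicalPhysics.QuantumLattice.OverlapLocality
import Literature.MathematicalPhysics.QuantumLattice.WilsonPropagatorHeavyMass

/-!
# Crux `FMClosureUnquenched` (stmt-QuantumFields-11512), line `thick-collar-far-stability` — stub `stub_resolvent`

Deterministic matrix algebra for one flavour of the Wilson–Dirac matrix `D` on the torus of side
`2S+1`: the four ASFH collar resolvent bounds (Rfwd)/(Rin)/(Rout)/(R2) in `ℓ¹` colour–spin
block-norm form, `cT = 4`.  Ingredients: block-diagonality of `(D_A ⊕ 1)⁻¹`, the resolvent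
identities `M⁻¹ = N⁻¹ + M⁻¹ (N − M) N⁻¹ = N⁻¹ + N⁻¹ (N − M) M⁻¹`, one expand-and-bound lemma
(`bn_mul_mul_le`), the hop support of `D` with the entry bound `‖D p q‖ ≤ 4` off the site diagonal
(`cut_term`), and the cut geometry of offset cubes (`cut_geometry`).  All vocabulary is local
notation expanding to the very `let`s of the registered statement.
-/

noncomputable section

namespace Summit.QuantumFields.QCD.Theorems.ThickCollarFarStability

open Literature.MathematicalPhysics.QuantumFieldTheory Literature.MathematicalPhysics.QuantumLattice
  Literature.Probability.LatticeModels

set_option quotPrecheck false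

-- notation: `Mat[V]` colour–spin matrices over sites `V`; `bn[M, y, z]`, `side[D, A] = D_A ⊕ 1`,
-- `WD[U, m]` = the statement's `bn`, `side`, `D`; `img[S, x, B]` the torus image of the offset Finset
-- `B` about `x`; `sphere`/`ebox`/`boxIn`/`boxOut` as in the statement (odd ball = `img[S, x, box 4 r]`)
local notation "Mat[" V "]" => Matrix (V × Fin 3 × Fin 4) (V × Fin 3 × Fin 4) ℂ
local notation "bn[" M ", " y ", " z "]" =>
  ∑ a : Fin 3, ∑ i : Fin 4, ∑ b : Fin 3, ∑ j : Fin 4, ‖M (y, a, i) (z, b, j)‖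
local notation "side[" D ", " A "]" =>
  Matrix.of fun p q => if p.1 ∈ A ∧ q.1 ∈ A then D p q else if p = q then 1 else 0
local notation "SU3" => Matrix.specialUnitaryGroup (Fin 3) ℂ
local notation "shift" => Literature.MathematicalPhysics.QuantumFieldTheory.Site.shift
local notation "WD[" U ", " m "]" => wilsonDirac (fundamentalRep (Fin 3)) U m 1
local notation "img[" S ", " x ", " B "]" => Finset.image (fun w => x + Torus.proj (2 * S + 1) w) B
local notation "sphere[" S ", " x ", " r "]" => img[S, x, (box 4 r).filter
  fun w : Literature.Probability.LatticeModels.Site 4 => ∃ i, w i = (r : ℤ) ∨ w i = -(r : ℤ)]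
local notation "ebox[" S ", " x ", " r "]" =>
  img[S, x, Fintype.piFinset fun _ : Fin 4 => Finset.Icc (-(r : ℤ) - 1) r]
local notation "boxIn[" S ", " x ", " r "]" =>
  img[S, x, (Fintype.piFinset fun _ : Fin 4 => Finset.Icc (-(r : ℤ) - 1) r).filter
    fun w : Literature.Probability.LatticeModels.Site 4 => ∃ i, w i = -(r : ℤ) - 1 ∨ w i = (r : ℤ)]
local notation "boxOut[" S ", " x ", " r "]" =>
  img[S, x, (Fintype.piFinset fun _ : Fin 4 => Finset.Icc (-(r : ℤ) - 2) (r + 1)).filter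
    fun w : Literature.Probability.LatticeModels.Site 4 => ∃ i, w i = -(r : ℤ) - 2 ∨ w i = (r : ℤ) + 1]

/-- Block norms are nonnegative. -/
private theorem bn_nonneg {V : Type*} (M : Mat[V]) (y z : V) : 0 ≤ bn[M, y, z] := by positivity

/-- Subadditivity of the block norm (sums and differences). -/
private theorem bn_add_le {V : Type*} (M N : Mat[V]) (y z : V) :
    bn[M + N, y, z] ≤ bn[M, y, z] + bn[N, y, z] ∧ bn[M - N, y, z] ≤ bn[M, y, z] + bn[N, y, z] := by
  simp only [← Finset.sum_add_distrib, Matrix.add_apply, Matrix.sub_apply]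
  constructor <;> refine Finset.sum_le_sum fun a _ => Finset.sum_le_sum fun i _ =>
    Finset.sum_le_sum fun b _ => Finset.sum_le_sum fun j _ => ?_
  exacts [norm_add_le _ _, norm_sub_le _ _]

/-- **Block-diagonality**: `(D_A ⊕ 1)⁻¹` vanishes between `A` and its complement (the side matrix
commutes with the `0/1` diagonal projection onto `A`, hence so does its inverse). -/
private theorem side_inv_apply_eq_zero {V : Type*} [Fintype V] [DecidableEq V] (D : Mat[V]) (A : Finset V)
    {p q : V × Fin 3 × Fin 4} (h : ¬ (p.1 ∈ A ↔ q.1 ∈ A)) : (side[D, A])⁻¹ p q = 0 := by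
  obtain ⟨e, he⟩ : ∃ e : V × Fin 3 × Fin 4 → ℂ, e = fun p => if p.1 ∈ A then 1 else 0 := ⟨_, rfl⟩
  have hEN : Matrix.diagonal e * side[D, A] = side[D, A] * Matrix.diagonal e := by
    ext p' q'
    simp only [Matrix.diagonal_mul, Matrix.mul_diagonal, Matrix.of_apply, he]
    by_cases hp : p'.1 ∈ A <;> by_cases hq : q'.1 ∈ A <;> simp [hp, hq] <;> rintro rfl <;>
      contradiction
  set N : Mat[V] := side[D, A]
  have hinv : Matrix.diagonal e * N⁻¹ = N⁻¹ * Matrix.diagonal e := by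
    by_cases hu : IsUnit N.det
    · calc Matrix.diagonal e * N⁻¹ = N⁻¹ * N * Matrix.diagonal e * N⁻¹ := by
            rw [Matrix.nonsing_inv_mul _ hu, one_mul]
        _ = N⁻¹ * Matrix.diagonal e := by
            rw [mul_assoc N⁻¹ N, ← hEN, mul_assoc, mul_assoc, Matrix.mul_nonsing_inv _ hu, mul_one]
    · rw [Matrix.nonsing_inv_apply_not_isUnit _ hu, mul_zero, zero_mul]
  have := congr_fun (congr_fun hinv p) q
  simp only [Matrix.diagonal_mul, Matrix.mul_diagonal, he] at this
  by_cases hp : p.1 ∈ A <;> by_cases hq : q.1 ∈ A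
  · exact (h (iff_of_true hp hq)).elim
  · simpa [hp, hq] using this
  · simpa [hp, hq] using this.symm
  · exact (h (iff_of_false hp hq)).elim

/-- Off-diagonal site blocks of `(D_A ⊕ 1)⁻¹` across the cut have block norm zero. -/
private theorem bn_side_inv_eq_zero {V : Type*} [Fintype V] [DecidableEq V] (D : Mat[V]) (A : Finset V)
    {y z : V} (h : ¬ (y ∈ A ↔ z ∈ A)) : bn[(side[D, A])⁻¹, y, z] = 0 :=
  Finset.sum_eq_zero fun a _ => Finset.sum_eq_zero fun i _ => Finset.sum_eq_zero fun b _ =>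
    Finset.sum_eq_zero fun j _ => by rw [side_inv_apply_eq_zero D A h, norm_zero]

/-- Resolvent identities `M⁻¹ = N⁻¹ + M⁻¹ (N − M) N⁻¹ = N⁻¹ + N⁻¹ (N − M) M⁻¹` (`M`, `N` invertible). -/
private theorem inv_eq_add_of_isUnit {n : Type*} [Fintype n] [DecidableEq n] (M N : Matrix n n ℂ)
    (hM : IsUnit M.det) (hN : IsUnit N.det) :
    M⁻¹ = N⁻¹ + M⁻¹ * (N - M) * N⁻¹ ∧ M⁻¹ = N⁻¹ + N⁻¹ * (N - M) * M⁻¹ := by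
  constructor
  · rw [mul_sub, sub_mul, Matrix.nonsing_inv_mul _ hM, one_mul, mul_assoc,
      Matrix.mul_nonsing_inv _ hN, mul_one]; abel
  · rw [mul_sub, sub_mul, Matrix.nonsing_inv_mul _ hN, one_mul, mul_assoc,
      Matrix.mul_nonsing_inv _ hM, mul_one]; abel

/-- Rearranging a double sum against an inner weighted double sum (bookkeeping for (R2)). -/
private theorem sum_mul_sum_eq {α β γ δ : Type*} (s : Finset α) (t : Finset β) (s' : Finset γ)
    (t' : Finset δ) (c : ℝ) (A : α → ℝ) (B : β → γ → ℝ) (C : δ → ℝ) :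
    ∑ u ∈ s, ∑ u' ∈ t, A u * (c * ∑ v ∈ s', ∑ v' ∈ t', B u' v * C v') =
      c * ∑ u ∈ s, ∑ u' ∈ t, ∑ v ∈ s', ∑ v' ∈ t', A u * B u' v * C v' := by
  simp only [Finset.mul_sum]
  exact Finset.sum_congr rfl fun _ _ => Finset.sum_congr rfl fun _ _ =>
    Finset.sum_congr rfl fun _ _ => Finset.sum_congr rfl fun _ _ => by ring

/-- Splitting a sum over `V × (Fin 3 × Fin 4)` into sites and colour–spin indices. -/
private theorem sum_prod3 {V : Type*} [Fintype V] (g : V × Fin 3 × Fin 4 → ℝ) :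
    ∑ p, g p = ∑ s, ∑ m : Fin 3 × Fin 4, g (s, m) :=
  Fintype.sum_prod_type _

/-- **Expand and bound.** If every non-vanishing term of `X H Y` between the site blocks `y`, `z`
passes through a pair `(p, p')` with `p` over `In`, `p'` over `Out` and `‖H p p'‖ ≤ c`, then
`bn (X H Y) y z ≤ c Σ_{s ∈ In} Σ_{s' ∈ Out} bn X y s · bn Y s' z`. -/
private theorem bn_mul_mul_le {V : Type*} [Fintype V] [DecidableEq V] (X H Y : Mat[V]) (y z : V)
    (In Out : Finset V) {c : ℝ} (hc : 0 ≤ c) (hH : ∀ (k k' : Fin 3 × Fin 4) (p p' : V × Fin 3 × Fin 4),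
      X (y, k) p * (H p p' * Y p' (z, k')) ≠ 0 → p.1 ∈ In ∧ p'.1 ∈ Out ∧ ‖H p p'‖ ≤ c) :
    bn[X * H * Y, y, z] ≤ c * ∑ s ∈ In, ∑ s' ∈ Out, bn[X, y, s] * bn[Y, s', z] := by
  have key : ∀ k k' : Fin 3 × Fin 4, ‖(X * H * Y) (y, k) (z, k')‖ ≤
      c * ((∑ s ∈ In, ∑ m : Fin 3 × Fin 4, ‖X (y, k) (s, m)‖) *
        ∑ s' ∈ Out, ∑ m' : Fin 3 × Fin 4, ‖Y (s', m') (z, k')‖) := fun k k' =>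
    calc ‖(X * H * Y) (y, k) (z, k')‖ = ‖∑ p, ∑ p', X (y, k) p * (H p p' * Y p' (z, k'))‖ := by
          rw [Matrix.mul_assoc]; simp only [Matrix.mul_apply, Finset.mul_sum]
      _ ≤ ∑ p, ∑ p', ‖X (y, k) p * (H p p' * Y p' (z, k'))‖ :=
          (norm_sum_le _ _).trans (Finset.sum_le_sum fun p _ => norm_sum_le _ _)
      _ = ∑ s, ∑ s', ∑ m : Fin 3 × Fin 4, ∑ m' : Fin 3 × Fin 4,
            ‖X (y, k) (s, m) * (H (s, m) (s', m') * Y (s', m') (z, k'))‖ := by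
          simp only [sum_prod3]; exact Finset.sum_congr rfl fun s _ => Finset.sum_comm
      _ ≤ ∑ s, ∑ s', ∑ m : Fin 3 × Fin 4, ∑ m' : Fin 3 × Fin 4, c * ((if s ∈ In then
            ‖X (y, k) (s, m)‖ else 0) * (if s' ∈ Out then ‖Y (s', m') (z, k')‖ else 0)) := by
          refine Finset.sum_le_sum fun s _ => Finset.sum_le_sum fun s' _ =>
            Finset.sum_le_sum fun m _ => Finset.sum_le_sum fun m' _ => ?_
          by_cases hne : X (y, k) (s, m) * (H (s, m) (s', m') * Y (s', m') (z, k')) = 0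
          · rw [hne, norm_zero]; positivity
          obtain ⟨hp, hp', hle⟩ := hH k k' _ _ hne
          rw [if_pos hp, if_pos hp', norm_mul, norm_mul]
          calc ‖X (y, k) (s, m)‖ * (‖H (s, m) (s', m')‖ * ‖Y (s', m') (z, k')‖)
              ≤ ‖X (y, k) (s, m)‖ * (c * ‖Y (s', m') (z, k')‖) := by gcongr
            _ = _ := by ring
      _ = c * ((∑ s, ∑ m : Fin 3 × Fin 4, if s ∈ In then ‖X (y, k) (s, m)‖ else 0) *
            ∑ s', ∑ m' : Fin 3 × Fin 4, if s' ∈ Out then ‖Y (s', m') (z, k')‖ else 0) := by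
          rw [Finset.sum_mul_sum]; simp only [Finset.sum_mul_sum]; simp only [Finset.mul_sum]
      _ = _ := by simp only [Finset.sum_ite_irrel, Finset.sum_const_zero, Finset.sum_ite_mem_eq]
  calc bn[X * H * Y, y, z] = ∑ k, ∑ k', ‖(X * H * Y) (y, k) (z, k')‖ := by
        simp only [Fintype.sum_prod_type]
    _ ≤ ∑ k : Fin 3 × Fin 4, ∑ k' : Fin 3 × Fin 4,
          c * ((∑ s ∈ In, ∑ m : Fin 3 × Fin 4, ‖X (y, k) (s, m)‖) *
            ∑ s' ∈ Out, ∑ m' : Fin 3 × Fin 4, ‖Y (s', m') (z, k')‖) :=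
        Finset.sum_le_sum fun k _ => Finset.sum_le_sum fun k' _ => key k k'
    _ = c * ((∑ k : Fin 3 × Fin 4, ∑ s ∈ In, ∑ m : Fin 3 × Fin 4, ‖X (y, k) (s, m)‖) *
          ∑ k' : Fin 3 × Fin 4, ∑ s' ∈ Out, ∑ m' : Fin 3 × Fin 4, ‖Y (s', m') (z, k')‖) := by
        rw [Finset.sum_mul_sum, Finset.mul_sum]; simp_rw [Finset.mul_sum]
    _ = c * ((∑ s ∈ In, bn[X, y, s]) * ∑ s' ∈ Out, bn[Y, s', z]) := by
        congr 2 <;> rw [Finset.sum_comm] <;> refine Finset.sum_congr rfl fun s _ => ?_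
        · simp only [Fintype.sum_prod_type]
        · rw [Finset.sum_comm]; simp only [Fintype.sum_prod_type]
    _ = _ := by rw [Finset.sum_mul_sum]

open scoped Matrix.Norms.L2Operator in
/-- **Cut terms**: if `D_A ⊕ 1` and `D` differ at `(q, q')` with `q` or `q'` over `A`, the pair
straddles the cut, is a nearest-neighbour hop, and `‖(D_A ⊕ 1 − D) q q'‖ = ‖D q q'‖ ≤ 4`
(`D = (m+4)·1 − Σ_μ W_μ`, `‖W_μ‖₂ ≤ 1`, entries bounded by the operator norm). -/
private theorem cut_term {L : ℕ} [NeZero L] (U : GaugeConfig 4 L SU3) (m₀ : ℝ) (A : Finset (TorusSite 4 L))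
    {q q' : TorusSite 4 L × Fin 3 × Fin 4} (h : (side[WD[U, m₀], A]) q q' ≠ (WD[U, m₀]) q q')
    (hA : q.1 ∈ A ∨ q'.1 ∈ A) : ¬ (q.1 ∈ A ↔ q'.1 ∈ A) ∧
      (∃ μ, q'.1 = shift q.1 μ ∨ q.1 = shift q'.1 μ) ∧ ‖(side[WD[U, m₀], A] - WD[U, m₀]) q q'‖ ≤ 4 := by
  simp only [Matrix.sub_apply, Matrix.of_apply] at h ⊢
  have key : ¬ (q.1 ∈ A ∧ q'.1 ∈ A) := fun hb => h (if_pos hb)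
  have hiff : ¬ (q.1 ∈ A ↔ q'.1 ∈ A) :=
    fun hi => key (hA.elim (fun hq => ⟨hq, hi.1 hq⟩) fun hq' => ⟨hi.2 hq', hq'⟩)
  have hne : q.1 ≠ q'.1 := fun e => hiff (by rw [e])
  have hqq : q ≠ q' := fun e => hne (by rw [e])
  rw [if_neg key, if_neg hqq] at h ⊢
  refine ⟨hiff, ?_, ?_⟩
  · by_contra hc; push Not at hc
    exact h (wilsonDirac_apply_eq_zero_of_far _ U m₀ 1 hne (fun μ => (hc μ).1) fun μ => (hc μ).2).symm
  · have hρ : ∀ g : SU3, fundamentalRep (Fin 3) g ∈ Matrix.unitaryGroup (Fin 3) ℂ :=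
      fun g => fundamentalRep_mem_unitaryGroup g
    rw [zero_sub, norm_neg, wilsonDirac_eq_sub_sum_wilsonHop _ hρ U m₀, Matrix.sub_apply,
      Matrix.smul_apply, Matrix.one_apply_ne hqq, smul_zero, zero_sub, norm_neg]
    exact (norm_apply_le_l2_opNorm _ q q').trans ((norm_sum_le _ _).trans
      ((Finset.sum_le_sum fun μ _ => l2_opNorm_wilsonHop_le _ hρ U μ).trans_eq (by simp)))

/-- **Cut geometry**: a nearest-neighbour hop out of the torus image of the offset cube
`B = [lo, hi]⁴` about `x` starts on the boundary layer of `B` (where `P` holds) and lands on the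
boundary layer of `B' = [lo-1, hi+1]⁴` (where `P'` holds). -/
private theorem cut_geometry {L : ℕ} (x : TorusSite 4 L) (lo hi : ℤ)
    {B B' : Finset (Literature.Probability.LatticeModels.Site 4)}
    {P P' : Literature.Probability.LatticeModels.Site 4 → Prop} [DecidablePred P] [DecidablePred P']
    (hB : ∀ w, w ∈ B ↔ ∀ i, lo ≤ w i ∧ w i ≤ hi) (hB' : ∀ w, w ∈ B' ↔ ∀ i, lo - 1 ≤ w i ∧ w i ≤ hi + 1)
    (hP : ∀ w i, w i = lo ∨ w i = hi → P w) (hP' : ∀ w i, w i = lo - 1 ∨ w i = hi + 1 → P' w)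
    {u u' : TorusSite 4 L} (hu : u ∈ B.image fun w => x + Torus.proj L w)
    (hu' : u' ∉ B.image fun w => x + Torus.proj L w) (hadj : ∃ μ, u' = shift u μ ∨ u = shift u' μ) :
    u ∈ (B.filter P).image (fun w => x + Torus.proj L w) ∧
      u' ∈ (B'.filter P').image fun w => x + Torus.proj L w := by
  obtain ⟨w, hwB, rfl⟩ := Finset.mem_image.1 hu
  have hw := (hB w).1 hwB
  obtain ⟨μ, hμ⟩ := hadj
  have hps : ∀ σ : ℤ, Torus.proj L (w + Pi.single μ σ) = Torus.proj L w + Pi.single μ (σ : ZMod L) :=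
    fun σ => funext fun i => by by_cases h : i = μ <;> simp [Torus.proj_apply, h]
  obtain ⟨σ, hσ, hu'eq⟩ : ∃ σ : ℤ, (σ = 1 ∨ σ = -1) ∧ x + Torus.proj L (w + Pi.single μ σ) = u' := by
    rcases hμ with h | h
    · exact ⟨1, Or.inl rfl, by rw [h, hps, Int.cast_one, ← add_assoc]; rfl⟩
    · refine ⟨-1, Or.inr rfl, ?_⟩
      rw [hps, Int.cast_neg, Int.cast_one, Pi.single_neg, ← add_assoc, h]
      exact add_neg_cancel_right _ _
  have hw'i : ∀ i, (w + Pi.single μ σ : Fin 4 → ℤ) i = w i + if i = μ then σ else 0 :=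
    fun i => by simp [Pi.single_apply]
  have hfail : ¬ (lo ≤ w μ + σ ∧ w μ + σ ≤ hi) := by
    refine fun hc => hu' (Finset.mem_image.2 ⟨w + Pi.single μ σ, (hB _).2 fun i => ?_, hu'eq⟩)
    rw [hw'i]
    split_ifs with h
    · subst h; exact hc
    · simpa using hw i
  refine ⟨Finset.mem_image.2 ⟨w, Finset.mem_filter.2 ⟨hwB, hP w μ ?_⟩, rfl⟩, Finset.mem_image.2
    ⟨_, Finset.mem_filter.2 ⟨(hB' _).2 fun i => ?_, hP' _ μ ?_⟩, hu'eq⟩⟩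
  · have := hw μ; rcases hσ with rfl | rfl <;> omega
  · rw [hw'i]; have := hw i; split_ifs <;> rcases hσ with rfl | rfl <;> omega
  · rw [hw'i, if_pos rfl]; have := hw μ; rcases hσ with rfl | rfl <;> omega

/-- `x ∈ ebox ℓ ⊆ ebox (3ℓ+2)` and `boxOut ℓ ⊆ ebox (3ℓ+2)`. -/
private theorem ebox_subset (S : ℕ) (x : TorusSite 4 (2 * S + 1)) (ℓ : ℕ) : x ∈ ebox[S, x, ℓ] ∧
    ebox[S, x, ℓ] ⊆ ebox[S, x, (3 * ℓ + 2 : ℕ)] ∧ boxOut[S, x, ℓ] ⊆ ebox[S, x, (3 * ℓ + 2 : ℕ)] := by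
  refine ⟨Finset.mem_image.2 ⟨0, Fintype.mem_piFinset.2 fun _ => Finset.mem_Icc.2 ⟨?_, ?_⟩, ?_⟩,
    ?_, ?_⟩ <;> try (simp only [Pi.zero_apply]; omega)
  · rw [add_eq_left]; exact funext fun i => by simp [Torus.proj_apply]
  all_goals intro u hu; obtain ⟨w, hw, rfl⟩ := Finset.mem_image.1 hu
  all_goals refine Finset.mem_image.2 ⟨w, Fintype.mem_piFinset.2 fun i => Finset.mem_Icc.2 ?_, rfl⟩
  · have := Finset.mem_Icc.1 (Fintype.mem_piFinset.1 hw i); push_cast; omega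
  · have := Finset.mem_Icc.1 (Fintype.mem_piFinset.1 (Finset.mem_filter.1 hw).1 i); push_cast; omega

/-- Cut geometry of the odd ball: a hop out of `ball r` goes from `sphere r` to `sphere (r+1)`. -/
private theorem ball_cut (S : ℕ) (x : TorusSite 4 (2 * S + 1)) (r : ℕ) {u u' : TorusSite 4 (2 * S + 1)}
    (hu : u ∈ img[S, x, box 4 r]) (hu' : u' ∉ img[S, x, box 4 r])
    (hadj : ∃ μ, u' = shift u μ ∨ u = shift u' μ) : u ∈ sphere[S, x, r] ∧ u' ∈ sphere[S, x, (r + 1 : ℕ)] :=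
  cut_geometry x (-(r : ℤ)) r (fun w => mem_box)
    (fun w => by rw [mem_box]; push_cast; exact forall_congr' fun i => by omega)
    (fun w i h => ⟨i, h.symm⟩) (fun w i h => ⟨i, by push_cast; omega⟩) hu hu' hadj

/-- Cut geometry of the even box: a hop out of `ebox r` goes from `boxIn r` to `boxOut r`. -/
private theorem ebox_cut (S : ℕ) (x : TorusSite 4 (2 * S + 1)) (r : ℕ) {u u' : TorusSite 4 (2 * S + 1)}
    (hu : u ∈ ebox[S, x, r]) (hu' : u' ∉ ebox[S, x, r]) (hadj : ∃ μ, u' = shift u μ ∨ u = shift u' μ) :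
    u ∈ boxIn[S, x, r] ∧ u' ∈ boxOut[S, x, r] :=
  cut_geometry x (-(r : ℤ) - 1) r (fun w => by simp only [Fintype.mem_piFinset, Finset.mem_Icc])
    (fun w => by simp only [Fintype.mem_piFinset, Finset.mem_Icc]; exact forall_congr' fun i => by omega)
    (fun w i h => ⟨i, h⟩) (fun w i h => ⟨i, by omega⟩) hu hu' hadj

/-- **Cut bounds.** For `N = D_A ⊕ 1` and Finsets `P ⊆ A`, `Q ⊆ Aᶜ` receiving the two ends of every
hop across the cut: `bn (X (N − D) N⁻¹) y₀ z₀ ≤ 4 Σ_{s ∈ Q} Σ_{s' ∈ P} bn X y₀ s · bn N⁻¹ s' z₀` for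
`z₀ ∈ A`, and `bn (N⁻¹ (N − D) Y) y₀ z₀ ≤ 4 Σ_{s ∈ P} Σ_{s' ∈ Q} bn N⁻¹ y₀ s · bn Y s' z₀` for `y₀ ∈ A`. -/
private theorem cut_bounds (S : ℕ) (U : GaugeConfig 4 (2 * S + 1) SU3) (m₀ : ℝ)
    (A P Q : Finset (TorusSite 4 (2 * S + 1))) (hcut : ∀ u u' : TorusSite 4 (2 * S + 1),
      u ∈ A → u' ∉ A → (∃ μ, u' = shift u μ ∨ u = shift u' μ) → u ∈ P ∧ u' ∈ Q)
    (X Y : Mat[TorusSite 4 (2 * S + 1)]) {y₀ z₀ : TorusSite 4 (2 * S + 1)} :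
    (z₀ ∈ A → bn[X * (side[WD[U, m₀], A] - WD[U, m₀]) * (side[WD[U, m₀], A])⁻¹, y₀, z₀] ≤
      4 * ∑ s ∈ Q, ∑ s' ∈ P, bn[X, y₀, s] * bn[(side[WD[U, m₀], A])⁻¹, s', z₀]) ∧
    (y₀ ∈ A → bn[(side[WD[U, m₀], A])⁻¹ * (side[WD[U, m₀], A] - WD[U, m₀]) * Y, y₀, z₀] ≤
      4 * ∑ s ∈ P, ∑ s' ∈ Q, bn[(side[WD[U, m₀], A])⁻¹, y₀, s] * bn[Y, s', z₀]) := by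
  set D : Mat[TorusSite 4 (2 * S + 1)] := WD[U, m₀]
  set N : Mat[TorusSite 4 (2 * S + 1)] := side[D, A]
  refine ⟨fun hz => bn_mul_mul_le X (N - D) N⁻¹ y₀ z₀ Q P (by norm_num) fun k k' q q' hne => ?_,
    fun hy => bn_mul_mul_le N⁻¹ (N - D) Y y₀ z₀ P Q (by norm_num) fun k k' q q' hne => ?_⟩ <;>
    have hH := sub_ne_zero.1 (left_ne_zero_of_mul (right_ne_zero_of_mul hne))
  · have hq' : q'.1 ∈ A := by
      by_contra h
      exact right_ne_zero_of_mul (right_ne_zero_of_mul hne)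
        (side_inv_apply_eq_zero D A fun hh => h (hh.2 hz))
    obtain ⟨hiff, hadj, hle⟩ := cut_term U m₀ A hH (Or.inr hq')
    obtain ⟨hi, ho⟩ := hcut _ _ hq' (fun h => hiff (iff_of_true h hq')) (hadj.imp fun _ h => h.symm)
    exact ⟨ho, hi, hle⟩
  · have hq : q.1 ∈ A := by
      by_contra h
      exact left_ne_zero_of_mul hne (side_inv_apply_eq_zero D A fun hh => h (hh.1 hy))
    obtain ⟨hiff, hadj, hle⟩ := cut_term U m₀ A hH (Or.inl hq)
    obtain ⟨hi, ho⟩ := hcut _ _ hq (fun h => hiff (iff_of_true hq h)) hadj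
    exact ⟨hi, ho, hle⟩

/-- **Forward bound** (the shape of (Rfwd) and of the inner step of (R2)): for `y₀ ∈ B`, `z₀ ∉ B`
and `N = D_{Bᶜ} ⊕ 1` invertible, `G = N⁻¹ + G (N − D) N⁻¹` read at `(y₀, z₀)` and `cut_bounds` give
`bn G y₀ z₀ ≤ 4 Σ_{s ∈ In} Σ_{s' ∈ Out} bn G y₀ s · bn N⁻¹ s' z₀` (hops out of `B`: `In → Out`). -/
private theorem gfwd (S : ℕ) (U : GaugeConfig 4 (2 * S + 1) SU3) (m₀ : ℝ)
    (B In Out : Finset (TorusSite 4 (2 * S + 1))) (hcut : ∀ u u' : TorusSite 4 (2 * S + 1),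
      u ∈ B → u' ∉ B → (∃ μ, u' = shift u μ ∨ u = shift u' μ) → u ∈ In ∧ u' ∈ Out)
    {y₀ z₀ : TorusSite 4 (2 * S + 1)} (hy : y₀ ∈ B) (hz : z₀ ∉ B)
    (hN : (side[WD[U, m₀], Bᶜ]).det ≠ 0) : bn[(WD[U, m₀])⁻¹, y₀, z₀] ≤
      4 * ∑ s ∈ In, ∑ s' ∈ Out, bn[(WD[U, m₀])⁻¹, y₀, s] * bn[(side[WD[U, m₀], Bᶜ])⁻¹, s', z₀] := by
  set D : Mat[TorusSite 4 (2 * S + 1)] := WD[U, m₀]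
  set N : Mat[TorusSite 4 (2 * S + 1)] := side[D, Bᶜ]
  by_cases hD : IsUnit D.det
  swap; · rw [Matrix.nonsing_inv_apply_not_isUnit _ hD]; simp
  have hzA : z₀ ∈ Bᶜ := Finset.mem_compl.2 hz
  have step := (congrArg (fun M => bn[M, y₀, z₀]) (inv_eq_add_of_isUnit D N hD
    (isUnit_iff_ne_zero.2 hN)).1).trans_le (bn_add_le N⁻¹ (D⁻¹ * (N - D) * N⁻¹) y₀ z₀).1
  rw [bn_side_inv_eq_zero D Bᶜ (fun h => Finset.mem_compl.1 (h.2 hzA) hy), zero_add] at step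
  exact step.trans ((cut_bounds S U m₀ Bᶜ Out In (fun u u' hu hu' hadj => (hcut u' u
    (by simpa using hu') (Finset.mem_compl.1 hu) (hadj.imp fun _ h => h.symm)).symm) D⁻¹ D).1 hzA)

/-- **Collar resolvent bounds** (registered stub `stub_resolvent` of line `thick-collar-far-stability`,
crux `PauliWegnerSea.FMClosureUnquenched`), `cT = 4`: (Rfwd) = `gfwd` for the odd ball; (Rin)
`N_W⁻¹ = G − G (N_W − D) N_W⁻¹` and (Rout) `N⁻¹ = G − N⁻¹ (N − D) G` by `cut_bounds`; (R2)
`G = N_W⁻¹ + N_W⁻¹ (N_W − D) G` by `cut_bounds`, then `gfwd` across `Λ = ebox (3ℓ+2)` for every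
`u' ∈ boxOut ℓ ⊆ Λ` (only the spanning diagram survives). -/
theorem stub_resolvent :
    ∃ cT : ℝ, 0 < cT ∧ ∀ (S : ℕ) (U : GaugeConfig 4 (2 * S + 1) (Matrix.specialUnitaryGroup (Fin 3) ℂ))
        (m₀ : ℝ) (x : TorusSite 4 (2 * S + 1)),
        let D : Matrix (TorusSite 4 (2 * S + 1) × Fin 3 × Fin 4) (TorusSite 4 (2 * S + 1) × Fin 3 × Fin 4) ℂ :=
          wilsonDirac (fundamentalRep (Fin 3)) U m₀ 1
        let bn : Matrix (TorusSite 4 (2 * S + 1) × Fin 3 × Fin 4) (TorusSite 4 (2 * S + 1) × Fin 3 × Fin 4) ℂ →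
            TorusSite 4 (2 * S + 1) → TorusSite 4 (2 * S + 1) → ℝ :=
          fun M y z => ∑ a : Fin 3, ∑ i : Fin 4, ∑ b : Fin 3, ∑ j : Fin 4, ‖M (y, a, i) (z, b, j)‖
        let side : Finset (TorusSite 4 (2 * S + 1)) →
            Matrix (TorusSite 4 (2 * S + 1) × Fin 3 × Fin 4) (TorusSite 4 (2 * S + 1) × Fin 3 × Fin 4) ℂ :=
          fun A => Matrix.of fun p q => if p.1 ∈ A ∧ q.1 ∈ A then D p q else if p = q then 1 else 0
        let ball : ℕ → Finset (TorusSite 4 (2 * S + 1)) := fun r =>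
          (box 4 r).image fun w => x + Torus.proj (2 * S + 1) w
        let sphere : ℕ → Finset (TorusSite 4 (2 * S + 1)) := fun r =>
          ((box 4 r).filter fun w : Literature.Probability.LatticeModels.Site 4 =>
              ∃ i, w i = (r : ℤ) ∨ w i = -(r : ℤ)).image
            fun w => x + Torus.proj (2 * S + 1) w
        let ebox : ℕ → Finset (TorusSite 4 (2 * S + 1)) := fun r =>
          (Fintype.piFinset fun _ : Fin 4 => Finset.Icc (-(r : ℤ) - 1) r).image
            fun w => x + Torus.proj (2 * S + 1) w
        let boxIn : ℕ → Finset (TorusSite 4 (2 * S + 1)) := fun r =>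
          ((Fintype.piFinset fun _ : Fin 4 => Finset.Icc (-(r : ℤ) - 1) r).filter
              fun w : Literature.Probability.LatticeModels.Site 4 =>
                ∃ i, w i = -(r : ℤ) - 1 ∨ w i = (r : ℤ)).image
            fun w => x + Torus.proj (2 * S + 1) w
        let boxOut : ℕ → Finset (TorusSite 4 (2 * S + 1)) := fun r =>
          ((Fintype.piFinset fun _ : Fin 4 => Finset.Icc (-(r : ℤ) - 2) (r + 1)).filter
              fun w : Literature.Probability.LatticeModels.Site 4 =>
                ∃ i, w i = -(r : ℤ) - 2 ∨ w i = (r : ℤ) + 1).image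
            fun w => x + Torus.proj (2 * S + 1) w
        (∀ r : ℕ, 1 ≤ r → r + 1 ≤ S → ∀ z : TorusSite 4 (2 * S + 1), z ∉ ball r →
          (side ((ball r)ᶜ)).det ≠ 0 →
            bn D⁻¹ x z ≤
              cT * ∑ p ∈ sphere r, ∑ p' ∈ sphere (r + 1), bn D⁻¹ x p * bn (side ((ball r)ᶜ))⁻¹ p' z) ∧
        ∀ ℓ : ℕ, 1 ≤ ℓ → ℓ + 2 ≤ S →
          (∀ u : TorusSite 4 (2 * S + 1), u ∈ ebox ℓ → D.det ≠ 0 →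
            bn (side (ebox ℓ))⁻¹ x u ≤
              bn D⁻¹ x u +
                cT * ∑ w' ∈ boxOut ℓ, ∑ w ∈ boxIn ℓ, bn D⁻¹ x w' * bn (side (ebox ℓ))⁻¹ w u) ∧
          (3 * ℓ + 4 ≤ S →
            (∀ v' y : TorusSite 4 (2 * S + 1), v' ∉ ebox (3 * ℓ + 2) → y ∉ ebox (3 * ℓ + 2) →
              D.det ≠ 0 →
                bn (side ((ebox (3 * ℓ + 2))ᶜ))⁻¹ v' y ≤
                  bn D⁻¹ v' y +
                    cT * ∑ w' ∈ boxOut (3 * ℓ + 2), ∑ w ∈ boxIn (3 * ℓ + 2),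
                      bn (side ((ebox (3 * ℓ + 2))ᶜ))⁻¹ v' w' * bn D⁻¹ w y) ∧
            (∀ y : TorusSite 4 (2 * S + 1), y ∉ ebox (3 * ℓ + 2) →
              (side (ebox ℓ)).det ≠ 0 → (side ((ebox (3 * ℓ + 2))ᶜ)).det ≠ 0 →
                bn D⁻¹ x y ≤
                  cT ^ 2 * ∑ u ∈ boxIn ℓ, ∑ u' ∈ boxOut ℓ,
                    ∑ v ∈ boxIn (3 * ℓ + 2), ∑ v' ∈ boxOut (3 * ℓ + 2),
                      bn (side (ebox ℓ))⁻¹ x u * bn D⁻¹ u' v *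
                        bn (side ((ebox (3 * ℓ + 2))ᶜ))⁻¹ v' y)) := by
  refine ⟨4, four_pos, fun S U m₀ x => ?_⟩
  dsimp only
  set D : Mat[TorusSite 4 (2 * S + 1)] := WD[U, m₀]
  refine ⟨fun r _ _ z hz hN => gfwd S U m₀ _ _ _ (fun u u' => ball_cut S x r) (Finset.mem_image.2
    ⟨0, zero_mem_box 4 r, by rw [add_eq_left]; exact funext fun i => by simp [Torus.proj_apply]⟩)
      hz hN, fun ℓ _ _ => ⟨fun u hu hD => ?_, fun _ => ⟨fun v' y hv' _ hD => ?_, fun y hy hW hP => ?_⟩⟩⟩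
  · -- (Rin)
    set N : Mat[TorusSite 4 (2 * S + 1)] := side[D, ebox[S, x, ℓ]]
    by_cases hN : IsUnit N.det
    swap; · rw [Matrix.nonsing_inv_apply_not_isUnit _ hN]; simp; positivity
    have h := eq_sub_of_add_eq (inv_eq_add_of_isUnit D N (isUnit_iff_ne_zero.2 hD) hN).1.symm
    exact ((congrArg (fun M => bn[M, x, u]) h).trans_le
      (bn_add_le D⁻¹ (D⁻¹ * (N - D) * N⁻¹) x u).2).trans (add_le_add le_rfl
        ((cut_bounds S U m₀ _ _ _ (fun w w' => ebox_cut S x ℓ) D⁻¹ D).1 hu))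
  · -- (Rout)
    set N : Mat[TorusSite 4 (2 * S + 1)] := side[D, (ebox[S, x, (3 * ℓ + 2 : ℕ)])ᶜ]
    by_cases hN : IsUnit N.det
    swap; · rw [Matrix.nonsing_inv_apply_not_isUnit _ hN]; simp; positivity
    have h := eq_sub_of_add_eq (inv_eq_add_of_isUnit D N (isUnit_iff_ne_zero.2 hD) hN).2.symm
    exact ((congrArg (fun M => bn[M, v', y]) h).trans_le
      (bn_add_le D⁻¹ (N⁻¹ * (N - D) * D⁻¹) v' y).2).trans (add_le_add le_rfl ((cut_bounds S U m₀ _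
        _ _ (fun w w' hw hw' hadj => (ebox_cut S x _ (by simpa using hw') (Finset.mem_compl.1 hw)
          (hadj.imp fun _ h => h.symm)).symm) D D⁻¹).2 (Finset.mem_compl.2 hv')))
  · -- (R2)
    set NW : Mat[TorusSite 4 (2 * S + 1)] := side[D, ebox[S, x, ℓ]]
    by_cases hDu : IsUnit D.det
    swap; · rw [Matrix.nonsing_inv_apply_not_isUnit _ hDu]; simp
    obtain ⟨hxW, hWΛ, hOΛ⟩ := ebox_subset S x ℓ
    have step := (congrArg (fun M => bn[M, x, y]) (inv_eq_add_of_isUnit D NW hDu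
      (isUnit_iff_ne_zero.2 hW)).2).trans_le (bn_add_le NW⁻¹ (NW⁻¹ * (NW - D) * D⁻¹) x y).1
    rw [bn_side_inv_eq_zero D _ (fun h => hy (hWΛ (h.1 hxW))), zero_add] at step
    refine (step.trans ((cut_bounds S U m₀ _ _ _ (fun w w' => ebox_cut S x ℓ) D D⁻¹).2 hxW)).trans ?_
    refine (mul_le_mul_of_nonneg_left (Finset.sum_le_sum fun u _ => Finset.sum_le_sum
      fun u' hu' => mul_le_mul_of_nonneg_left (gfwd S U m₀ _ _ _ (fun w w' => ebox_cut S x _)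
        (hOΛ hu') hy hP) (bn_nonneg NW⁻¹ x u)) (by norm_num)).trans (le_of_eq ?_)
    rw [sum_mul_sum_eq, pow_two, mul_assoc]

end Summit.QuantumFields.QCD.Theorems.ThickCollarFarStability

end
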